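import Summits.QuantumFields.YangMills.Theorems.SwapVirialDeficitBlowUpGnomonicStratumBSeamFloor
import HarnessLib

/-!
# THE B-POINT SEAM FLOOR IN COORDINATES: `[(|u|²z₀′ − ζ)² + |u|²(2x₀′ + z₀′ + ζ)²]/(225·L⁶·(1+|u|²)²) ≤ Q_B(d)`, `ζ = u₂z₁′ − u₁z₂′`
# (free-hands support of ⟨stmt-QuantumFields-24197⟩ `SwapVirialDeficit.SwapGluedStiffness`; region (Rd) of LEAD g98's skeleton ➎ — sequel of ✓`fibre_raySecond_ge_stratumB_seam`)

Reading ✓`fibre_raySecond_ge_stratumB_seam` in components (end hub: `Ā·P·A = (re P, imI P, −imJ P, −imK P)` by ✓`conj_end_hub`; `x̂_B = ±(1,0,u₁,u₂)/√(1+|u|²)`):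
`g = [X′, x̂_B*] + [x̂_B, X′ + x̂_B*·Z′] = (2/(1+|u|²))·(0; |u|²z₀′ − ζ, u₂(2x₀′ + z₀′ + ζ), −u₁(2x₀′ + z₀′ + ζ))`, so
* `radialUnit_gnoLetter_transverse_components`;
* ★★★ `fibre_raySecond_ge_stratumB_seam_coords (ha) (hre) (ε) (hz) (hε) (u₁ u₂ d)`:
  `[(|u|²z₀′ − ζ)² + |u|²·(2x₀′ + z₀′ + ζ)²]/(225·L⁶·(1+|u|²)²) ≤ (d²/ds²)F̂(η_B + s·ξ_B(d))|₀` — the axial direction `x₀′` is stiff with coefficient `4|u|²/(225L⁶(1+|u|²)²)`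
  (coupled to `z₀′ + ζ(z′)`, absorbed by the `z`-floor of ✓`fibre_raySecond_ge_stratumB_eta` in the sequel), degenerating exactly on the crossing `Σ = {u = 0}`.

HONEST LABEL: quaternion component algebra on a landed floor; regions' stiffness, ⟨24197⟩ ∕ ⟨24194⟩ ∕ ⟨24497⟩ OPEN; own crux ⟨22884⟩ OPEN (blocked-on ⟨19935⟩); the Yang–Mills mass gap
is NOT proved; no summit is proved by a line.  THEOREMS ONLY (0 `def`, 0 `sorry`), standard axioms.  Width seat ym-line-sfw-p2-w3 g66 (cell ym-idea-1, free hands),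
`--supports stmt-QuantumFields-24197`.  References: [cite: Luscher1983, §2]; [folklore].
-/

set_option autoImplicit false

noncomputable section

open MeasureTheory Quaternion
open scoped BigOperators Quaternion
open Literature.MathematicalPhysics.QuantumFieldTheory hiding SU2
open Literature.MathematicalPhysics.QuantumLattice
open Literature.Analysis.Calculus (radialUnit radialUnit_def norm_radialUnit)

namespace Summit.QuantumFields.YangMills.Theorems.SwapVirialDeficit.BlowUpRing

open Summit.QuantumFields.YangMills.Theorems.FemtoTransferGap
open Summit.QuantumFields.YangMills.Theorems.SwapTwistDeficit.ToronLog (axisPoint)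

variable {L : ℕ} [NeZero L]

omit [NeZero L] in
/-- Components of the transverse base letter `x̂_B = ν(±(1,0,u₁,u₂)) = ±(1,0,u₁,u₂)/√(1+|u|²)`. [folklore] -/
theorem radialUnit_gnoLetter_transverse_components (ε : Bool) (u₁ u₂ : ℝ) :
    (radialUnit (gnoLetter ε ![0, u₁, u₂])).re = (Real.sqrt (1 + (u₁ ^ 2 + u₂ ^ 2)))⁻¹ * gnoSign ε ∧
      (radialUnit (gnoLetter ε ![0, u₁, u₂])).imI = 0 ∧
      (radialUnit (gnoLetter ε ![0, u₁, u₂])).imJ = (Real.sqrt (1 + (u₁ ^ 2 + u₂ ^ 2)))⁻¹ * (gnoSign ε * u₁) ∧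
      (radialUnit (gnoLetter ε ![0, u₁, u₂])).imK = (Real.sqrt (1 + (u₁ ^ 2 + u₂ ^ 2)))⁻¹ * (gnoSign ε * u₂) := by
  rw [radialUnit_def, norm_gnoLetter_transverse, gnoLetter_eq]
  refine ⟨?_, ?_, ?_, ?_⟩ <;> simp [gnomonicQuat]

set_option maxHeartbeats 800000 in
/-- ★★★ **THE B-POINT SEAM FLOOR IN COORDINATES** (end hub `a ≠ 0`, `re a = 0`; `ε_z = +`, followers `+`; `ζ = u₂z₁′ − u₁z₂′`):
`[(|u|²z₀′ − ζ)² + |u|²(2x₀′ + z₀′ + ζ)²]/(225·L⁶·(1+|u|²)²) ≤ (d²/ds²)F̂(η_B + s·ξ_B(d))|₀`. [cite: Luscher1983, §2] -/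
theorem fibre_raySecond_ge_stratumB_seam_coords {a : ℍ} (ha : a ≠ 0) (hre : a.re = 0) (ε : GnoSign L) (hz : ε.2.1 = true) (hε : ε.2.2 = fun _ => true)
    (u₁ u₂ : ℝ) (d : ℝ × (Fin 3 → ℝ) × (Fin 3 → ℝ) × (Fol L → Fin 3 → ℝ)) :
    (((u₁ ^ 2 + u₂ ^ 2) * d.2.2.1 0 - (u₂ * d.2.2.1 1 - u₁ * d.2.2.1 2)) ^ 2 +
        (u₁ ^ 2 + u₂ ^ 2) * (2 * d.1 + d.2.2.1 0 + (u₂ * d.2.2.1 1 - u₁ * d.2.2.1 2)) ^ 2) / (225 * (L : ℝ) ^ 6 * (1 + (u₁ ^ 2 + u₂ ^ 2)) ^ 2) ≤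
      iteratedDeriv 2 (fun s : ℝ => gnoDeficit (fun _ => false) (fun _ => 1) a ε
        (((((![0, u₁, u₂] : Fin 3 → ℝ), (0 : Fin 3 → ℝ)), ((0 : Fin 3 → ℝ), (0 : Fol L → Fin 3 → ℝ))) : GnoCoord L) +
          s • ((((![d.1, 0, 0] : Fin 3 → ℝ), d.2.1), (d.2.2.1, d.2.2.2)) : GnoCoord L))) 0 := by
  have hL : (0 : ℝ) < L := by exact_mod_cast NeZero.pos L
  have h := fibre_raySecond_ge_stratumB_seam (L := L) ha hre ε hz hε u₁ u₂ d
  refine le_trans (le_of_eq ?_) h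
  -- names
  obtain ⟨A, hA⟩ : ∃ A : ℍ, A = radialUnit (axisPoint a) := ⟨_, rfl⟩
  obtain ⟨N, hN⟩ : ∃ N : ℝ, N = Real.sqrt (1 + (u₁ ^ 2 + u₂ ^ 2)) := ⟨_, rfl⟩
  obtain ⟨σ, hσ⟩ : ∃ σ : ℝ, σ = gnoSign ε.1.1 := ⟨_, rfl⟩
  obtain ⟨xh, hxh⟩ : ∃ q : ℍ, q = radialUnit (gnoLetter ε.1.1 ![0, u₁, u₂]) := ⟨_, rfl⟩
  obtain ⟨X', hX'⟩ : ∃ q : ℍ, q = N⁻¹ • (σ • (gnomonicQuat ![d.1, 0, 0]).im) := ⟨_, rfl⟩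
  obtain ⟨Z', hZ'⟩ : ∃ q : ℍ, q = (gnomonicQuat d.2.2.1).im := ⟨_, rfl⟩
  rw [← hA, ← hN, ← hσ, ← hxh, ← hZ'] 
  rw [← hX']
  -- components
  have hAc := end_hub_components ha hre
  rw [← hA] at hAc
  obtain ⟨hxre, hximI, hximJ, hximK⟩ := radialUnit_gnoLetter_transverse_components ε.1.1 u₁ u₂
  rw [← hxh, ← hN, ← hσ] at hxre hximJ hximK
  rw [← hxh] at hximI
  obtain ⟨hPre, hPimI, hPimJ, hPimK⟩ := gnomonicQuat_im_components (![d.1, 0, 0] : Fin 3 → ℝ)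
  obtain ⟨hZre, hZimI, hZimJ, hZimK⟩ := gnomonicQuat_im_components (d.2.2.1)
  rw [← hZ'] at hZre hZimI hZimJ hZimK
  have hX're : X'.re = 0 := by rw [hX', Quaternion.re_smul, Quaternion.re_smul, hPre]; simp
  have hX'imI : X'.imI = N⁻¹ * (σ * d.1) := by
    rw [hX', Quaternion.imI_smul, Quaternion.imI_smul, hPimI]; simp [smul_eq_mul]
  have hX'imJ : X'.imJ = 0 := by rw [hX', Quaternion.imJ_smul, Quaternion.imJ_smul, hPimJ]; simp
  have hX'imK : X'.imK = 0 := by rw [hX', Quaternion.imK_smul, Quaternion.imK_smul, hPimK]; simp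
  -- the two conjugates by the end hub
  obtain ⟨hw0re, hw0imI, hw0imJ, hw0imK⟩ := conj_end_hub hAc xh
  obtain ⟨hcXre, hcXimI, hcXimJ, hcXimK⟩ := conj_end_hub hAc X'
  -- name the conjugates and `W'`
  obtain ⟨w₀, hw₀⟩ : ∃ q : ℍ, q = star A * xh * A := ⟨_, rfl⟩
  obtain ⟨cX, hcX⟩ : ∃ q : ℍ, q = star A * X' * A := ⟨_, rfl⟩
  rw [← hw₀] at hw0re hw0imI hw0imJ hw0imK
  rw [← hcX] at hcXre hcXimI hcXimJ hcXimK
  rw [← hw₀, ← hcX]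
  rw [hximI] at hw0imI
  rw [hX're] at hcXre; rw [hX'imI] at hcXimI; rw [hX'imJ, neg_zero] at hcXimJ; rw [hX'imK, neg_zero] at hcXimK
  -- the commutator sum `g` through its components
  obtain ⟨g, hg⟩ : ∃ q : ℍ, q = X' * w₀ + xh * (cX + w₀ * Z') - ((cX + w₀ * Z') * xh + w₀ * X') := ⟨_, rfl⟩
  rw [← hg]
  have hgre : g.re = 0 := by
    rw [hg]
    simp only [Quaternion.re_sub, Quaternion.re_add, Quaternion.re_mul, Quaternion.imI_mul, Quaternion.imJ_mul, Quaternion.imK_mul,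
      Quaternion.imI_add, Quaternion.imJ_add, Quaternion.imK_add, Quaternion.re_add,
      hxre, hximI, hximJ, hximK, hX're, hX'imI, hX'imJ, hX'imK, hw0re, hw0imI, hw0imJ, hw0imK, hcXre, hcXimI, hcXimJ, hcXimK, hZre, hZimI, hZimJ, hZimK]
    ring
  have hgimI : g.imI = 2 * N⁻¹ ^ 2 * σ ^ 2 * ((u₁ ^ 2 + u₂ ^ 2) * d.2.2.1 0 - (u₂ * d.2.2.1 1 - u₁ * d.2.2.1 2)) := by
    rw [hg]
    simp only [Quaternion.imI_sub, Quaternion.imI_add, Quaternion.re_mul, Quaternion.imI_mul, Quaternion.imJ_mul, Quaternion.imK_mul,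
      Quaternion.re_add, Quaternion.imJ_add, Quaternion.imK_add,
      hxre, hximI, hximJ, hximK, hX're, hX'imI, hX'imJ, hX'imK, hw0re, hw0imI, hw0imJ, hw0imK, hcXre, hcXimI, hcXimJ, hcXimK, hZre, hZimI, hZimJ, hZimK]
    ring
  have hgimJ : g.imJ = 2 * N⁻¹ ^ 2 * σ ^ 2 * (u₂ * (2 * d.1 + d.2.2.1 0 + (u₂ * d.2.2.1 1 - u₁ * d.2.2.1 2))) := by
    rw [hg]
    simp only [Quaternion.imJ_sub, Quaternion.imJ_add, Quaternion.re_mul, Quaternion.imI_mul, Quaternion.imJ_mul, Quaternion.imK_mul,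
      Quaternion.re_add, Quaternion.imI_add, Quaternion.imK_add,
      hxre, hximI, hximJ, hximK, hX're, hX'imI, hX'imJ, hX'imK, hw0re, hw0imI, hw0imJ, hw0imK, hcXre, hcXimI, hcXimJ, hcXimK, hZre, hZimI, hZimJ, hZimK]
    ring
  have hgimK : g.imK = -(2 * N⁻¹ ^ 2 * σ ^ 2 * (u₁ * (2 * d.1 + d.2.2.1 0 + (u₂ * d.2.2.1 1 - u₁ * d.2.2.1 2)))) := by
    rw [hg]
    simp only [Quaternion.imK_sub, Quaternion.imK_add, Quaternion.re_mul, Quaternion.imI_mul, Quaternion.imJ_mul, Quaternion.imK_mul,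
      Quaternion.re_add, Quaternion.imI_add, Quaternion.imJ_add,
      hxre, hximI, hximJ, hximK, hX're, hX'imI, hX'imJ, hX'imK, hw0re, hw0imI, hw0imJ, hw0imK, hcXre, hcXimI, hcXimJ, hcXimK, hZre, hZimI, hZimJ, hZimK]
    ring
  have hnorm : ‖g‖ ^ 2 = g.re ^ 2 + g.imI ^ 2 + g.imJ ^ 2 + g.imK ^ 2 := by
    rw [sq, ← Quaternion.normSq_eq_norm_mul_self, Quaternion.normSq_def']
  rw [hnorm, hgre, hgimI, hgimJ, hgimK]
  -- scalars
  have hσ2 : σ ^ 2 = 1 := by rw [hσ]; exact gnoSign_sq ε.1.1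
  have hu1 : (0 : ℝ) < 1 + (u₁ ^ 2 + u₂ ^ 2) := by positivity
  have ht2 : N⁻¹ ^ 2 = (1 + (u₁ ^ 2 + u₂ ^ 2))⁻¹ := by rw [inv_pow, hN, Real.sq_sqrt hu1.le]
  rw [hσ2, ht2]
  have hL6 : (L : ℝ) ^ 6 ≠ 0 := by positivity
  field_simp
  ring

end Summit.QuantumFields.YangMills.Theorems.SwapVirialDeficit.BlowUpRing

end
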